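/-
Copyright (c) 2026 the pub-hodgecm-mathlib formalisation cell (harness21).  Prover seat hodgecm-mathlib-LH4-p11 (g3), req620 Track A «(D-RAM) FOUR-FRAME» squad
(dealer LH4-plan (g11) WORD #56 (b): (κ-B₂) payer «TYPE 2, UNSIGNED»; generic arithmetic piece «κ-BOX-SUM₂», the tv-2 twin of LH4-p14 (g3)'s «κ-BOX-SUM»).  2026-09-04.
-/
import Summits.HodgeConjecture.HodgeConjecture.Theorems.F0P3cDyRamStableCountBoxReindex   -- ★ B10 PART 2 FILE 1 (LH4-p04 (g2)): `vec3_eq_iff`, `sum_box_eq_triple_sum`, `triple_sum_eq_diag_add_planes`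
import Mathlib.Algebra.Ring.GeomSum
import HarnessLib

/-!
# Crux `H413`, (D-RAM) FOUR-FRAME, U3 §K-R — «κ-BOX-SUM₂» FILE 1∕3: THE BLOCKS (geometric tools, on-branch block, tube rows, telescoping, glue window, exponent bookkeeping)

Cell `hodgecm-mathlib` (D-0151), FLOOR 0, crux item H413 = `stmt-HodgeConjecture-24833`, route of record `HCCMUnconditional`; lane `--supports stmt-HodgeConjecture-24833 --as helper`
(count-neutral).  THEOREMS ONLY (no `def`, no instance, no notation, no `sorry`).  Pure finite-sum arithmetic over `ℚ` — no lattices, no fields.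

THE ROAD («κ-BOX-SUM₂», three files).  The (κ-B₂) child `F0P3cDyRamFourFrameU3.stub_U3_kappaCount_typeTwo_mult` of tree U3 ED. 10 (:498) asks for
`|Σᶠ_{M ∈ 𝓛₀(T), type-2-polarisable} κ_i(M)·w(M)| = ampl q k (B + τ d)∕4`.  After ★ `F0P3cDyRamStrataDecompositionGeneric` (LH4-p10 (g3)) the left side is a sum over the axis
box `a : Fin 3 → Fin (Bx+1)` of per-stratum sums `v a`, and these are the TYPE-2 κ-SOCKETS (on-branch ★ `F0P3cDyRamDiagonalKappaSplitCountTwoSockets`; glued: LH4-p09 (g3)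
LETTER κB-G₂ v1 §4, typists F0P3-p01 (g31) ∕ LH4-p13 (g3); core-hanging: LH4-p06 (g3) LETTER κB-H₂ v1 §4, typists LH4-p07 (g5) ∕ LH4-p08 (g3)).  «κ-BOX-SUM₂» is the
ARITHMETIC of that box sum with the socket right-hand sides as hypotheses and the K-dependent signs replaced by rational PARAMETERS (`ω` on the on-branch ∕ tube cells,
`εG p j` on the glue cells of foot `p`, `εH` on the equilateral core-hanging cells) — LH4-p14 (g3)'s frozen type-0 grammar (`sum_box_kappa_eq_typeZero`) with the type-2 tables:
`(q − 1)·Σ_{a ∈ box} v a = SIGN·(q^k − q^(k − B₂))`, `B₂ = (n_i + 4 − 2(d%2) − 3d)∕2 = B + tauOfRecord d`.  VALIDATED before typing by literal transcription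
(`F0/P3c/LH4/LH4-p11/g3/kappa_boxsum_tv2_leanshape.v1.LH4p11g3.py` 997cfe04add05bbb: 2025 rows, 0 bad).

THIS FILE (1∕3): the one-dimensional blocks.  §1 geometric ∕ re-indexing tools; §2 the on-branch block `Σ_{s odd, 2d−1 ≤ s ≤ n} q^{⌊s∕2⌋}` and one tube row
`Σ_{s even} q^{r−1+s∕2}((q−1)[2d ≤ s] − [s+2 = 2d])` in closed form; §3 the TELESCOPING LEMMA (on-branch + tube rows = one interval of consecutive powers); §4 the glue
window of a foot re-indexed onto the top consecutive powers; §5 the slot vectors read at a slot; §6 the exponent identities (`K = k`, `K − C = k − B₂`, …) proved once by a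
parity split (so that the assembler in FILE 3 never calls `omega` on `⌊·∕2⌋`-terms).
HONEST LABEL.  Count-neutral; nothing printed is asserted; (KMS) and its children stay PROVER TARGETS (empirical census laws in diagonal-model currency) until their payers land;
`HC_CM` is proved only modulo the 7 printed citations (2 remaining named inputs: hLiu418 = `stmt-HodgeConjecture-24832`, h413 = `stmt-HodgeConjecture-24833`) until rung 0 closes.

## References
* [Rogawski1990] J. D. Rogawski, *Automorphic Representations of Unitary Groups in Three Variables*, Ann. of Math. Stud. 123 (1990), §4.9 Prop. 4.9.1 (b) p. 55 (the κ-count).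
* [Kottwitz1986BaseChangeUnits] R. E. Kottwitz, *Base change for unit elements of Hecke algebras*, Compositio Math. 60 (1986), §1 pp. 240–241.
-/

set_option autoImplicit false

namespace Summit.HodgeConjecture.HodgeConjecture.Cruxes.H413.F0P3cDyRamKappaCountBoxSumTwoBlocks

open Finset

/-! ## §1  Arithmetic tools: geometric blocks and re-indexing of indicator sums -/

/-- `(q − 1)·Σ_{j ∈ [a,b)} q^j = q^b − q^a` (`a ≤ b`). [folklore] -/
theorem mul_sum_Ico_pow (q : ℚ) {a b : ℕ} (hab : a ≤ b) : (q - 1) * ∑ j ∈ Ico a b, q ^ j = q ^ b - q ^ a := by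
  rw [mul_comm, geom_sum_Ico_mul q hab]

/-- `(q − 1)·Σ_{j ∈ [a,b)} q^j = q^b − q^a` when `a ≤ b`, and `0 = q^b − q^b` otherwise — the truncated form used with ℕ-subtraction bounds. [folklore] -/
theorem mul_sum_Ico_pow' (q : ℚ) (a b : ℕ) : (q - 1) * ∑ j ∈ Ico a b, q ^ j = q ^ (max a b) - q ^ a := by
  rcases le_or_gt a b with h | h
  · rw [mul_sum_Ico_pow q h, max_eq_right h]
  · rw [Ico_eq_empty_of_le h.le, sum_empty, mul_zero, max_eq_left h.le, sub_self]

/-- **RE-INDEXING AN INDICATOR SUM OVER `range (B+1)` ONTO AN INTERVAL**: if `f` maps `{r ≤ B | P r}` bijectively onto `[a, b)` with inverse `g`, then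
`Σ_{r ≤ B} [P r]·F r = Σ_{j ∈ [a,b)} G j` whenever `F r = G (f r)`. [folklore] -/
theorem sum_range_ite_eq_sum_Ico {B a b : ℕ} (P : ℕ → Prop) [DecidablePred P] (F : ℕ → ℚ) (G : ℕ → ℚ) (f g : ℕ → ℕ)
    (hf : ∀ r, r ≤ B → P r → a ≤ f r ∧ f r < b ∧ g (f r) = r ∧ F r = G (f r))
    (hg : ∀ j, a ≤ j → j < b → g j ≤ B ∧ P (g j) ∧ f (g j) = j) :
    ∑ r ∈ range (B + 1), (if P r then F r else 0) = ∑ j ∈ Ico a b, G j := by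
  rw [← sum_filter]
  refine sum_nbij' f g ?_ ?_ ?_ ?_ ?_
  · intro r hr
    simp only [mem_filter, mem_range] at hr
    have h := hf r (by omega) hr.2
    exact mem_Ico.2 ⟨h.1, h.2.1⟩
  · intro j hj
    rw [mem_Ico] at hj
    have h := hg j hj.1 hj.2
    exact mem_filter.2 ⟨mem_range.2 (by omega), h.2.1⟩
  · intro r hr
    simp only [mem_filter, mem_range] at hr
    exact (hf r (by omega) hr.2).2.2.1
  · intro j hj
    rw [mem_Ico] at hj
    exact (hg j hj.1 hj.2).2.2
  · intro r hr
    simp only [mem_filter, mem_range] at hr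
    exact (hf r (by omega) hr.2).2.2.2

/-- An indicator sum over `range (B+1)` supported at a single point `r₀ ≤ B` is its value there; off the range it is `0`. [folklore] -/
theorem sum_range_ite_single {B : ℕ} (P : ℕ → Prop) [DecidablePred P] (F : ℕ → ℚ) (r₀ : ℕ) (hP : ∀ r, P r → r = r₀) :
    ∑ r ∈ range (B + 1), (if P r then F r else 0) = if P r₀ ∧ r₀ ≤ B then F r₀ else 0 := by
  by_cases h : P r₀ ∧ r₀ ≤ B
  · rw [if_pos h, sum_eq_single_of_mem r₀ (mem_range.2 (by omega)) (fun r _ hr => if_neg (fun hPr => hr (hP r hPr))), if_pos h.1]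
  · rw [if_neg h]
    refine sum_eq_zero fun r hr => if_neg fun hPr => h ⟨?_, ?_⟩
    · rw [← hP r hPr]; exact hPr
    · rw [← hP r hPr]; exact Nat.lt_succ_iff.1 (mem_range.1 hr)


/-! ## §2  The on-branch block and one tube row of the slot's own plane, in closed form -/

/-- **ON-BRANCH BLOCK (type 2)**: `Σ_{1 ≤ t ≤ n, t odd, 2d ≤ t+1} q^{⌊t∕2⌋} = Σ_{j ∈ [d−1, ⌊(n+1)∕2⌋)} q^j`. [folklore] -/
theorem onBranch_block (q : ℚ) {d n B : ℕ} (hd : 1 ≤ d) (hnB : n ≤ B) :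
    ∑ t ∈ range (B + 1), (if 1 ≤ t ∧ 2 * d ≤ t + 1 ∧ ¬ 2 ∣ t ∧ t ≤ n then q ^ (t / 2) else 0) = ∑ j ∈ Ico (d - 1) ((n + 1) / 2), q ^ j := by
  refine sum_range_ite_eq_sum_Ico _ _ _ (fun t => t / 2) (fun j => 2 * j + 1) ?_ ?_
  · intro t _ ht
    obtain ⟨h1, h2, h3, h4⟩ := ht
    exact ⟨by omega, by omega, by omega, rfl⟩
  · intro j hj1 hj2
    exact ⟨by omega, ⟨by omega, by omega, by omega, by omega⟩, by omega⟩

/-- **ONE TUBE ROW (type 2), slot-own plane, row `r` (odd, `1 ≤ r`)**: the cells `t = r + s`, `s` even, `t ≤ n`, weigh `q^{r−1+s∕2}·((q−1)[2d ≤ s] − [s+2 = 2d])`; their sum is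
`(q^{max(r−1+d, r+⌊(n−r)∕2⌋)} − q^{r−1+d}) − [r + 2d − 2 ≤ n]·q^{r+d−2}` (`2 ≤ d`). [folklore] -/
theorem tube_row (q : ℚ) {d n B : ℕ} (hd : 2 ≤ d) (hnB : n ≤ B) (r : ℕ) (hr : 1 ≤ r) :
    ∑ t ∈ range (B + 1), (if r < t ∧ 2 ∣ (t - r) ∧ t ≤ n then
        q ^ (r - 1 + (t - r) / 2) * ((if 2 * d ≤ t - r then q - 1 else 0) - (if t - r + 2 = 2 * d then 1 else 0)) else 0) =
      (q ^ (max (r - 1 + d) (r + (n - r) / 2)) - q ^ (r - 1 + d)) - (if r + 2 * d - 2 ≤ n then q ^ (r + d - 2) else 0) := by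
  have hpt : ∀ t : ℕ, (if r < t ∧ 2 ∣ (t - r) ∧ t ≤ n then
        q ^ (r - 1 + (t - r) / 2) * ((if 2 * d ≤ t - r then q - 1 else 0) - (if t - r + 2 = 2 * d then 1 else 0)) else 0) =
      (if r < t ∧ 2 ∣ (t - r) ∧ t ≤ n ∧ 2 * d ≤ t - r then (q - 1) * q ^ (r - 1 + (t - r) / 2) else 0) -
      (if r < t ∧ 2 ∣ (t - r) ∧ t ≤ n ∧ t - r + 2 = 2 * d then q ^ (r - 1 + (t - r) / 2) else 0) := by
    intro t
    split_ifs <;> first | ring1 | (exfalso; omega)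
  simp only [hpt, sum_sub_distrib]
  congr 1
  · rw [sum_range_ite_eq_sum_Ico (fun t => r < t ∧ 2 ∣ (t - r) ∧ t ≤ n ∧ 2 * d ≤ t - r) (fun t => (q - 1) * q ^ (r - 1 + (t - r) / 2))
      (fun j => (q - 1) * q ^ j) (fun t => r - 1 + (t - r) / 2) (fun j => 2 * j + 2 - r - 2 * (d - 1) + 2 * (d - 1)) (a := r - 1 + d) (b := r + (n - r) / 2) ?_ ?_,
      ← mul_sum, mul_sum_Ico_pow']
    · intro t _ ht
      obtain ⟨h1, h2, h3, h4⟩ := ht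
      exact ⟨by omega, by omega, by omega, rfl⟩
    · intro j hj1 hj2
      exact ⟨by omega, ⟨by omega, by omega, by omega, by omega⟩, by omega⟩
  · rw [sum_range_ite_single (fun t => r < t ∧ 2 ∣ (t - r) ∧ t ≤ n ∧ t - r + 2 = 2 * d) _ (r + 2 * d - 2) (fun t ht => by omega)]
    by_cases h : r + 2 * d - 2 ≤ n
    · rw [if_pos h, if_pos ⟨⟨by omega, by omega, h, by omega⟩, by omega⟩, show r - 1 + (r + 2 * d - 2 - r) / 2 = r + d - 2 by omega]
    · rw [if_neg h, if_neg (fun h' => h h'.1.2.2.1)]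

/-! ## §3  Telescoping: on-branch block + tube rows = one interval of powers -/

/-- **TELESCOPING LEMMA.**  With `N″ = ⌊(n+1)∕2⌋` and the closed tube rows of §2 written in `ρ` (`r = 2ρ+1`):
`Σ_{j ∈ [d−1, N″)} q^j + Σ_{ρ < R} ([d+ρ+1 ≤ N″](q^{ρ+N″} − q^{2ρ+d}) − [d+ρ ≤ N″] q^{2ρ+d−1}) = Σ_{j ∈ [2R+d−1, N″+R)} q^j`. [folklore] -/
theorem telescope (q : ℚ) {d : ℕ} (hd : 1 ≤ d) (N R : ℕ) :
    ∑ j ∈ Ico (d - 1) N, q ^ j + ∑ ρ ∈ range R, ((if d + ρ + 1 ≤ N then q ^ (ρ + N) - q ^ (2 * ρ + d) else 0) - (if d + ρ ≤ N then q ^ (2 * ρ + d - 1) else 0)) =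
      ∑ j ∈ Ico (2 * R + d - 1) (N + R), q ^ j := by
  induction R with
  | zero => simp
  | succ R ih =>
    rw [sum_range_succ, ← add_assoc, ih]
    by_cases h1 : d + R + 1 ≤ N
    · rw [if_pos h1, if_pos (by omega),
        sum_eq_sum_Ico_succ_bot (show 2 * R + d - 1 < N + R by omega), sum_eq_sum_Ico_succ_bot (show 2 * R + d - 1 + 1 < N + R by omega),
        show 2 * R + d - 1 + 1 + 1 = 2 * (R + 1) + d - 1 by omega, show 2 * R + d - 1 + 1 = 2 * R + d by omega,
        show N + (R + 1) = N + R + 1 by omega, sum_Ico_succ_top (show 2 * (R + 1) + d - 1 ≤ N + R by omega), show R + N = N + R by omega]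
      ring
    · rw [if_neg h1]
      by_cases h2 : d + R ≤ N
      · rw [if_pos h2, show N + R = 2 * R + d - 1 + 1 by omega, sum_Ico_succ_top le_rfl, Ico_self, sum_empty,
          Ico_eq_empty_of_le (show N + (R + 1) ≤ 2 * (R + 1) + d - 1 by omega), sum_empty]
        ring
      · rw [if_neg h2, Ico_eq_empty_of_le (show N + R ≤ 2 * R + d - 1 by omega), Ico_eq_empty_of_le (show N + (R + 1) ≤ 2 * (R + 1) + d - 1 by omega),
          sum_empty]
        ring

/-- The closed tube row of §2 at an odd `r`, rewritten in `ρ = ⌊r∕2⌋` and `N″ = ⌊(n+1)∕2⌋` (the summand of the telescoping lemma). [folklore] -/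
theorem row_eq_inner (q : ℚ) {d n r : ℕ} (hd : 1 ≤ d) (hr : ¬ 2 ∣ r) :
    (q ^ (max (r - 1 + d) (r + (n - r) / 2)) - q ^ (r - 1 + d)) - (if r + 2 * d - 2 ≤ n then q ^ (r + d - 2) else 0) =
      (if d + r / 2 + 1 ≤ (n + 1) / 2 then q ^ (r / 2 + (n + 1) / 2) - q ^ (2 * (r / 2) + d) else 0) -
        (if d + r / 2 ≤ (n + 1) / 2 then q ^ (2 * (r / 2) + d - 1) else 0) := by
  congr 1
  · by_cases h : d + r / 2 + 1 ≤ (n + 1) / 2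
    · rw [if_pos h, max_eq_right (by omega), show r + (n - r) / 2 = r / 2 + (n + 1) / 2 by omega, show r - 1 + d = 2 * (r / 2) + d by omega]
    · rw [if_neg h, max_eq_left (by omega), sub_self]
  · by_cases h : r + 2 * d - 2 ≤ n
    · rw [if_pos h, if_pos (by omega), show r + d - 2 = 2 * (r / 2) + d - 1 by omega]
    · rw [if_neg h, if_neg (by omega)]

/-- **THE TUBE BLOCK OF THE SLOT'S OWN PLANE** (rows `r` odd, `1 ≤ r ≤ μ`, `μ` = the smaller of the two other depths), re-indexed by `ρ = ⌊r∕2⌋ < ⌊(μ+1)∕2⌋` into the summands of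
the telescoping lemma. [folklore] -/
theorem tube_block (q : ℚ) {d n μ B : ℕ} (hd : 1 ≤ d) (hμB : μ ≤ B) :
    ∑ r ∈ range (B + 1), (if 1 ≤ r ∧ ¬ 2 ∣ r ∧ r ≤ μ then
        (q ^ (max (r - 1 + d) (r + (n - r) / 2)) - q ^ (r - 1 + d)) - (if r + 2 * d - 2 ≤ n then q ^ (r + d - 2) else 0) else 0) =
      ∑ ρ ∈ range ((μ + 1) / 2), ((if d + ρ + 1 ≤ (n + 1) / 2 then q ^ (ρ + (n + 1) / 2) - q ^ (2 * ρ + d) else 0) -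
        (if d + ρ ≤ (n + 1) / 2 then q ^ (2 * ρ + d - 1) else 0)) := by
  rw [range_eq_Ico ((μ + 1) / 2)]
  refine sum_range_ite_eq_sum_Ico _ _ _ (fun r => r / 2) (fun ρ => 2 * ρ + 1) ?_ ?_
  · intro r _ hr
    obtain ⟨h1, h2, h3⟩ := hr
    refine ⟨by omega, by omega, by omega, ?_⟩
    rw [row_eq_inner q hd h2]
  · intro ρ _ hρ
    exact ⟨by omega, ⟨by omega, by omega, by omega⟩, by omega⟩

/-! ## §4  The glue window of a foot (and the diagonal) re-indexed onto the top powers -/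

/-- **THE GLUE WINDOW.**  Foot depth `μ` (`μ ≡ d (mod 2)`), apex excess `s₀` (even; `s₀ = 0` is the equilateral diagonal), bracket threshold `c₀ ≥ 1` on `c = ⌈(r − μ)∕2⌉`:
the cells `r` odd, `μ < r ≤ 2μ`, `r − μ ≤ μ − d + 1`, `c₀ ≤ c`, each weighing `q^{r + s₀∕2 − c}`, are EXACTLY the consecutive powers `q^j`, `j ∈ [K − C, K)`,
`K = μ + s₀∕2 + (μ − d)∕2 + 1`, `C = (μ − d)∕2 + 2 − d % 2 − c₀` (ℕ-truncated). [folklore] -/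
theorem glue_window (q : ℚ) {d μ s₀ c₀ B : ℕ} (hd : 1 ≤ d) (hdμ : d ≤ μ) (hμ : μ % 2 = d % 2) (hs₀ : 2 ∣ s₀) (hc₀ : 1 ≤ c₀) (hμB : 2 * μ ≤ B) :
    ∑ r ∈ range (B + 1), (if ¬ 2 ∣ r ∧ μ < r ∧ r ≤ 2 * μ ∧ r - μ ≤ μ - d + 1 ∧ c₀ ≤ (r - μ + 1) / 2 then q ^ (r + s₀ / 2 - (r - μ + 1) / 2) else 0) =
      ∑ j ∈ Ico (μ + s₀ / 2 + (μ - d) / 2 + 1 - ((μ - d) / 2 + 2 - d % 2 - c₀)) (μ + s₀ / 2 + (μ - d) / 2 + 1), q ^ j := by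
  refine sum_range_ite_eq_sum_Ico _ _ _ (fun r => r + s₀ / 2 - (r - μ + 1) / 2) (fun j => 2 * j + 1 - d % 2 - μ - 2 * (s₀ / 2)) ?_ ?_
  · intro r _ hr
    obtain ⟨h1, h2, h3, h4, h5⟩ := hr
    exact ⟨by omega, by omega, by omega, rfl⟩
  · intro j hj1 hj2
    exact ⟨by omega, ⟨by omega, by omega, by omega, by omega, by omega⟩, by omega⟩

/-! ## §5  Slot vectors read at a slot -/

/-- `![a,b,c] 0 = a`. [folklore] -/
theorem vec3_0 {α : Type*} (a b c : α) : (![a, b, c] : Fin 3 → α) 0 = a := rfl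
/-- `![a,b,c] 1 = b`. [folklore] -/
theorem vec3_1 {α : Type*} (a b c : α) : (![a, b, c] : Fin 3 → α) 1 = b := rfl
/-- `![a,b,c] 2 = c`. [folklore] -/
theorem vec3_2 {α : Type*} (a b c : α) : (![a, b, c] : Fin 3 → α) 2 = c := rfl

/-- The foot-`0` tube vector read at slot `i`. [folklore] -/
theorem vecT0 (A : ℚ) (i : Fin 3) : (![A, 0, 0] : Fin 3 → ℚ) i = if i = 0 then A else 0 := by fin_cases i <;> rfl
/-- The foot-`1` tube vector read at slot `i`. [folklore] -/
theorem vecT1 (A : ℚ) (i : Fin 3) : (![0, A, 0] : Fin 3 → ℚ) i = if i = 1 then A else 0 := by fin_cases i <;> rfl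
/-- The foot-`2` tube vector read at slot `i`. [folklore] -/
theorem vecT2 (A : ℚ) (i : Fin 3) : (![0, 0, A] : Fin 3 → ℚ) i = if i = 2 then A else 0 := by fin_cases i <;> rfl

/-- The foot-`0` glue vector read at slot `i`: own bracket `P` at slot `0`, cross bracket `Q` elsewhere. [folklore] -/
theorem vecG0 (P Q : Prop) [Decidable P] [Decidable Q] (e : Fin 3 → ℚ) (i : Fin 3) :
    (![if P then e 0 else 0, if Q then e 1 else 0, if Q then e 2 else 0] : Fin 3 → ℚ) i = if i = 0 then (if P then e i else 0) else (if Q then e i else 0) := by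
  fin_cases i <;> rfl
/-- The foot-`1` glue vector read at slot `i`. [folklore] -/
theorem vecG1 (P Q : Prop) [Decidable P] [Decidable Q] (e : Fin 3 → ℚ) (i : Fin 3) :
    (![if Q then e 0 else 0, if P then e 1 else 0, if Q then e 2 else 0] : Fin 3 → ℚ) i = if i = 1 then (if P then e i else 0) else (if Q then e i else 0) := by
  fin_cases i <;> rfl
/-- The foot-`2` glue vector read at slot `i`. [folklore] -/
theorem vecG2 (P Q : Prop) [Decidable P] [Decidable Q] (e : Fin 3 → ℚ) (i : Fin 3) :
    (![if Q then e 0 else 0, if Q then e 1 else 0, if P then e 2 else 0] : Fin 3 → ℚ) i = if i = 2 then (if P then e i else 0) else (if Q then e i else 0) := by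
  fin_cases i <;> rfl

/-! ## §6  Exponent bookkeeping (leg depth `m`, apex depth `n`, all `≡ d (mod 2)`, shift `2k + d = 2m + n + 2`) -/

/-- `K = k` for the glue-window top exponent. [folklore] -/
theorem exp_K {d m n k : ℕ} (hm : m % 2 = d % 2) (hn : n % 2 = d % 2) (hdm : d ≤ m) (hmn : m ≤ n) (hk : 2 * k + d = 2 * m + n + 2) :
    m + (n - m) / 2 + (m - d) / 2 + 1 = k := by
  rcases Nat.mod_two_eq_zero_or_one d with hε | hε <;> (rw [hε] at hm hn; omega)

/-- `K = k` for the diagonal (equilateral key). [folklore] -/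
theorem exp_KD {d m k : ℕ} (hm : m % 2 = d % 2) (hdm : d ≤ m) (hk : 2 * k + d = 2 * m + m + 2) :
    m + 0 / 2 + (m - d) / 2 + 1 = k := by
  rcases Nat.mod_two_eq_zero_or_one d with hε | hε <;> (rw [hε] at hm; omega)

/-- The cross-slot (and equilateral) deficit: `K − C = k − B₂` with `c₀ = d`, `n_i = m`. [folklore] -/
theorem exp_cross {d m n k : ℕ} (hd : 2 ≤ d) (hm : m % 2 = d % 2) (hn : n % 2 = d % 2) (hdm : d ≤ m) (hk : 2 * k + d = 2 * m + n + 2) :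
    k - ((m - d) / 2 + 2 - d % 2 - d) = k - (m + 4 - 2 * (d % 2) - 3 * d) / 2 := by
  rcases Nat.mod_two_eq_zero_or_one d with hε | hε <;> (rw [hε] at hm hn ⊢; omega)

/-- Own slot, alive excess (`m + 2d ≤ n`): the glue window starts exactly on top of the telescoped block. [folklore] -/
theorem exp_own_top {d m n k : ℕ} (hd : 2 ≤ d) (hm : m % 2 = d % 2) (hn : n % 2 = d % 2) (hdm : d ≤ m) (hk : 2 * k + d = 2 * m + n + 2) :
    k - ((m - d) / 2 + 2 - d % 2 - 1) = (n + 1) / 2 + (m + 1) / 2 := by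
  rcases Nat.mod_two_eq_zero_or_one d with hε | hε <;> (rw [hε] at hm hn ⊢; omega)

/-- Own slot, alive excess: the bottom of the telescoped block is `k − B₂`. [folklore] -/
theorem exp_own_bot {d m n k : ℕ} (hd : 2 ≤ d) (hm : m % 2 = d % 2) (hn : n % 2 = d % 2) (hdm : d ≤ m) (hal : m + 2 * d ≤ n) (hk : 2 * k + d = 2 * m + n + 2) :
    2 * ((m + 1) / 2) + d - 1 = k - (n + 4 - 2 * (d % 2) - 3 * d) / 2 := by
  rcases Nat.mod_two_eq_zero_or_one d with hε | hε <;> (rw [hε] at hm hn ⊢; omega)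

/-- Own slot, dead excess (`m < n < m + 2d`): `K − C = k − B₂` with `c₀ = d − (n−m)∕2`. [folklore] -/
theorem exp_own_dead {d m n k : ℕ} (hm : m % 2 = d % 2) (hn : n % 2 = d % 2) (hdm : d ≤ m) (hmn : m < n) (hal : ¬ m + 2 * d ≤ n)
    (hk : 2 * k + d = 2 * m + n + 2) :
    k - ((m - d) / 2 + 2 - d % 2 - (2 * d - (n - m)) / 2) = k - (n + 4 - 2 * (d % 2) - 3 * d) / 2 := by
  rcases Nat.mod_two_eq_zero_or_one d with hε | hε <;> (rw [hε] at hm hn ⊢; omega)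

/-- Own slot, alive excess: the bracket threshold is `c₀ = 1`. [folklore] -/
theorem max_own_alive {d m n : ℕ} (hal : m + 2 * d ≤ n) : max 1 ((2 * d - (n - m)) / 2) = 1 := by
  rw [show (2 * d - (n - m)) / 2 = 0 by omega, max_eq_left (by norm_num)]

/-- Own slot, dead excess: the bracket threshold is `c₀ = d − (n−m)∕2 ≥ 1`. [folklore] -/
theorem max_own_dead {d m n : ℕ} (hm : m % 2 = d % 2) (hn : n % 2 = d % 2) (hmn : m < n) (hal : ¬ m + 2 * d ≤ n) :
    max 1 ((2 * d - (n - m)) / 2) = (2 * d - (n - m)) / 2 :=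
  max_eq_right (by rcases Nat.mod_two_eq_zero_or_one d with hε | hε <;> (rw [hε] at hm hn; omega))

end Summit.HodgeConjecture.HodgeConjecture.Cruxes.H413.F0P3cDyRamKappaCountBoxSumTwoBlocks
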